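import Literature.MathematicalPhysics.QuantumFieldTheory.BalabanImbrieJaffe1984to88.BIJ88Eq242HiggsCovarianceTorusCwt

/-!
# `BalabanImbrieJaffe1984to88.BIJ88Eq242HiggsCovariancePrintNorm` — T. Bałaban, J. Imbrie, A. Jaffe, *Effective action and cluster properties
of the abelian Higgs model*, Commun. Math. Phys. **114** (1988) 257–315 [BalabanImbrieJaffe1988], §2 pp. 263–265 [PDF 7–9], (2.34)/(2.40)–(2.47):
**[6] (5.6) WITH `k`-UNIFORM CONSTANTS, AND (2.42)/(2.45)/(2.41)/(2.46)/(2.47), FOR THE PRINT-NORMALIZED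
`C^{(k)}_Λ(u) = [(Δ^{print}_{k,loc}(u) + κ′P(u_k))|_Λ]^{−1}`, `Δ^{print}_{k,loc}(u) = (a_k/A)·Δ_{k,loc}(u)`** — gen 15's `deltaLocT A ε⁻¹ u k …`
carries the counting normalization `A = α_kL^{kd′}` (gen 18: *"deltaLocT = (A/a_k)·Δ^{print}_{k,loc}, the printed coefficient reads κ = (A/a_k)·aL^{−2}"*),
so the [6] (5.6) constants `(γ₅₆, c₅₆)` of gen 23's `BIJ88Eq242HiggsCovarianceTorusCwt` scale like `A/a_k = L^{k(d′−2)}ε^{−2}`; rescaling by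
`a_k/A` gives the operator of (2.40) AS PRINTED, `Δ^{print}_{k,loc}(u) + κ′P(u_k)` (`κ′ = aL^{−2}`), whose (5.6) constants
`γ_P = c240(γ₀, κ′)(1 − σ) − E₅₆` and `c_P = a_k(1 + m·a_kc₀e^{δ₀}) + κ′L^{−2d′}e^{δ₀(L−1)}` do NOT grow with `k` (they depend on `a_k ∈ (0, a]`,
`κ′`, `σ`, `L^{2k}θ`, `m`, `R/L^k`, `R₁/L^k`, `c₀`, `δ₀`, `d′`, `L` only) — so p13's cube-size conditions `M ≥ 5`, `M > K_R(γ_P, c_P, δ₀)`,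
`M > Θ₁(γ_P, c_P, δ₀)`, `θ_W < 1`, `K₀ ≤ e^{cs}` are conditions on `M = O(1)` and `r(e_k)` as the print has them (*"ω is a walk on a lattice of
spacing M = O(1)"*, p. 264).  The covariances are related by `C^{print} = (A/a_k)·C^{gen 15}`.

statement-level skeleton of published theorems with citation tags; proofs where landed; nothing here is a claim about the Yang–Mills mass gap

Print p. 264: *"We define C^{(k)}_Λ(u) = [(Δ_{k,loc}(u) + aL^{−2}Q(u)*Q(u)|_Λ]^{−1}. (2.40) This is of course a nonlocal operator, but by (2.38),
C^{(k)}_Λ(u)^{−1} is bounded below and a random walk expansion as in [6] can be used … The basic expansion has the form C^{(k)}_Λ(u) = Σ_ω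
C^{(k)}_{Λ,ω}(u), (2.42) where ω is a walk on a lattice of spacing M = O(1)."*

CONTENTS.
* §1 scaling: **`hyp56_smul`** ([6] (5.6) for `sA` with `(sγ₀, sc₀, δ₀)`, `s ≥ 0`), `realify_smul`, `compress_smul`, **`reOp_smul`**,
  `op240_smul_of_mul_eq` (`op240 (r•Δ) κ′ v = r • op240 Δ κ v` when `rκ = κ′`), `isUnit_compress_smul`, **`compress_inv_smul`**
  (`((rH)|_Λ)^{−1} = r^{−1}(H|_Λ)^{−1}`: `C^{print} = (A/a_k)C^{gen 15}`).
* §2 the `k`-uniform constants **`gammaP`**, **`cP`** (`gamma56 = (A/a_k)·gammaP`: `gamma56_eq`; `c56 = (A/a_k)·cP`) and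
  **`hyp56_printNorm_gen`**: `0 < γ_P ∧ 0 ≤ c_P ∧ B4.Hyp56 Λ′ (reOp Λ (Δ^{print}_{k,loc}(u) + κ′P(u_k))) γ_P c_P δ₀ ∧` invertibility, from gen 23's
  `hyp56_deltaLocT_gen` (row-restricted `_gen` inputs, torus-exterior depths, half-torus `cdist ≤ T` on `Λ`).
* §3 THE MEMBERS FOR THE PRINTED TORUS DATA (gen 23's binder list of `BIJ88Eq242HiggsCovarianceTorusCwt` §4 verbatim):
  **`hyp56_printNorm_smallPlaquette_torus_cwt`**, **`eq242_printNorm_…`** ((2.42), complex `HasSum` over all walks),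
  **`eq245_printNorm_…`** ((2.45), typed `Eq245`), **`decay241_walk_printNorm_…`** ((2.41) walk route, torus distance), **`ineq246_printNorm_…`**
  ((2.46), typed `Ineq246`), **`close247_printNorm_…`** ((2.47), typed `Close` in the torus distance) — the cube-size conditions now at the
  `k`-UNIFORM `(γ_P, c_P, δ₀)`.

HONEST SCOPE / DIVERGENCE.  (i) As gen 23's `BIJ88Eq242HiggsCovarianceTorusCwt` (realified coordinates + complex forms; p13's walk data; `Ω =
T_η`; half-torus reference box; u-locality clauses in gen 23's `BIJ88DeltaLocULocalityTorus`).  (ii) `k`-UNIFORMITY is displayed, not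
quantified: `γ_P`, `c_P` are explicit expressions free of `A`; that `E₅₆` is small and `a_k`, `m`, `R/L^k` bounded in the print's regime
(`θL^{2k} ≪ 1`, radii `= O(r(e_k))` multiples of `L^k`) is the business of the callers.  (iii) `κ′` is any nonnegative real (print `aL^{−2}`).
Imports: gen 23 `BIJ88Eq242HiggsCovarianceTorusCwt` (→ `BIJ88Eq242HiggsCovarianceTorus`, gen 22 `BIJ88DeltaLocSmallPlaquetteTorusCwt`).
Literature + Mathlib only.  Unit `lit-balaban-p31` (literature-prover-lit-balaban-p31-g23-0), 2026-08-23.  NOT summit progress.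
-/

open scoped BigOperators Matrix ComplexConjugate
open Finset Matrix

namespace Literature.MathematicalPhysics.QuantumFieldTheory.BalabanImbrieJaffe1984to88.BIJ88Eq242HiggsCovariancePrintNorm

open Literature.MathematicalPhysics.QuantumFieldTheory.Balaban1983to89
open BIJ88Sect3Statements (U1 toC starB)
open BIJ85BlockAveragesTorus BIJ85BlockAveragesTorusK
open BIJ88NeumannPropagator227Torus (gBox)
open BIJ88DeltaLoc234Torus (deltaLocT)
open BIJ88NeumannPropagatorFlatDecayCube (isBlockUnion_cubeT)
open BIJ88Cutoffs21 (cutoff)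
open BIJ88LocWeights227Torus (cubeFam lamFam sum_abs_lamT_le_one cutoff_mem_unitInterval cubeFam_fits)
open BIJ88Close231RegularTorusCwt (deepRows)
open BIJ88Decay241RegularTorusCwt (lamFam_symm cutoff_T_symm)
open BIJ85AbelianStokes (plaqC)
open BIJ88NeumannNoZeroModesTorus (IsBlockUnion innerK isBlockUnion_univ)
open BIJ85Ineq732FlatRegion (starB_innerK_univ)
open BIJ88Eq240FlatTorus (realify compress op240 pOp c240)
open B4Sect5Proof (latticeConst)
open BIJ88DeltaLocSmallPlaquetteTorusCwt (inputs_smallPlaquette rows_of_deep)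
open BIJ88RandomWalk242 BIJ88Eq242Lattice BIJ88Ineq246Lattice B4Sect5CubeBounds
open BIJ88Eq242HiggsCovarianceTorus
open BIJ88Eq242HiggsCovarianceTorusCwt

noncomputable section

variable {P : Params} {j : ℕ}

/-! ## §1 Scaling of [6] (5.6), of the realification and of the (2.40) operator -/

section Scaling

/-- **[6] (5.6) scales**: if `A` satisfies (5.6) with `(γ₀, c₀, δ₀)` and `s ≥ 0`, then `sA` satisfies it with `(sγ₀, sc₀, δ₀)`.
[cite: Balaban1983RegularityDecay, (5.6) p.594] -/
theorem hyp56_smul {d N : ℕ} {Ω : Finset (Fin d → ℤ)} {A : Matrix (B4.Idx Ω N) (B4.Idx Ω N) ℝ} {γ₀ c₀ δ₀ s : ℝ} (hs : 0 ≤ s)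
    (h : B4.Hyp56 Ω A γ₀ c₀ δ₀) : B4.Hyp56 Ω (s • A) (s * γ₀) (s * c₀) δ₀ := by
  obtain ⟨h1, h2, h3⟩ := h
  refine ⟨h1.smul s, fun v => ?_, fun p q => ?_⟩
  · have e : ∑ p, v p * (s • A).mulVec v p = s * ∑ p, v p * A.mulVec v p := by
      rw [Matrix.smul_mulVec, Finset.mul_sum]
      refine Finset.sum_congr rfl fun p _ => ?_
      rw [Pi.smul_apply, smul_eq_mul]; ring
    rw [e, mul_assoc]
    exact mul_le_mul_of_nonneg_left (h2 v) hs
  · rw [Matrix.smul_apply, smul_eq_mul, abs_mul, abs_of_nonneg hs, mul_assoc]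
    exact mul_le_mul_of_nonneg_left (h3 p q) hs

/-- realification is `ℝ`-linear: `realify (sM) = s·realify M` for real `s`. [cite: BalabanImbrieJaffe1988, (4.9) p.275] -/
theorem realify_smul {ι : Type*} (s : ℝ) (M : Matrix ι ι ℂ) : realify ((s : ℂ) • M) = s • realify M := by
  ext p q
  simp only [realify, Matrix.of_apply, Matrix.smul_apply, smul_eq_mul, Complex.re_ofReal_mul, Complex.im_ofReal_mul]
  split_ifs <;> ring

/-- restriction to `Λ` is linear. [cite: BalabanImbrieJaffe1988, (2.39) p.264] -/
theorem compress_smul {S : Type*} (Λ : Finset S) (s : ℂ) (M : Matrix S S ℂ) : compress Λ (s • M) = s • compress Λ M := rfl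

/-- **the charted realified operator is `ℝ`-linear**: `reOp Λ (sH) = s·reOp Λ H`. [cite: BalabanImbrieJaffe1988, (2.40) p.264] -/
theorem reOp_smul (Λ : Finset (Balaban1983to89.Site P j)) (s : ℝ) (H : Matrix (Balaban1983to89.Site P j) (Balaban1983to89.Site P j) ℂ) :
    reOp Λ ((s : ℂ) • H) = s • reOp Λ H := by
  unfold reOp
  rw [compress_smul, realify_smul, Matrix.reindex_apply, Matrix.reindex_apply, Matrix.submatrix_smul]
  rfl

/-- rescaling the (2.40) operator: `(rΔ) + κ′P = r·(Δ + κP)` when `rκ = κ′`. [cite: BalabanImbrieJaffe1988, (2.40) p.264] -/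
theorem op240_smul_of_mul_eq (Δ : Matrix (Balaban1983to89.Site P j) (Balaban1983to89.Site P j) ℂ) (V : GaugeField P j U1) {r κ κ' : ℝ}
    (h : r * κ = κ') : op240 ((r : ℂ) • Δ) κ' V = (r : ℂ) • op240 Δ κ V := by
  unfold op240
  rw [smul_add, smul_smul, ← Complex.ofReal_mul, h]

/-- a nonzero multiple of an invertible restricted operator is invertible. [cite: BalabanImbrieJaffe1988, (2.40) p.264] -/
theorem isUnit_compress_smul {Λ : Finset (Balaban1983to89.Site P j)} {H : Matrix (Balaban1983to89.Site P j) (Balaban1983to89.Site P j) ℂ}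
    (hU : IsUnit (compress Λ H)) {r : ℝ} (hr : r ≠ 0) : IsUnit (compress Λ ((r : ℂ) • H)) := by
  rw [compress_smul, Matrix.isUnit_iff_isUnit_det, Matrix.det_smul, isUnit_iff_ne_zero]
  rw [Matrix.isUnit_iff_isUnit_det, isUnit_iff_ne_zero] at hU
  exact mul_ne_zero (pow_ne_zero _ (Complex.ofReal_ne_zero.2 hr)) hU

/-- **`C^{print} = (A/a_k)·C`**: the inverse of a rescaled invertible restricted operator, `((rH)|_Λ)^{−1} = r^{−1}·(H|_Λ)^{−1}` (`r ≠ 0`).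
[cite: BalabanImbrieJaffe1988, (2.40) p.264] -/
theorem compress_inv_smul {Λ : Finset (Balaban1983to89.Site P j)} {H : Matrix (Balaban1983to89.Site P j) (Balaban1983to89.Site P j) ℂ}
    (hU : IsUnit (compress Λ H)) {r : ℝ} (hr : r ≠ 0) : (compress Λ ((r : ℂ) • H))⁻¹ = ((r : ℂ)⁻¹) • (compress Λ H)⁻¹ := by
  rw [compress_smul]
  refine Matrix.inv_eq_left_inv ?_
  rw [Matrix.smul_mul, Matrix.mul_smul, smul_smul, inv_mul_cancel₀ (Complex.ofReal_ne_zero.2 hr), one_smul,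
    Matrix.nonsing_inv_mul _ ((Matrix.isUnit_iff_isUnit_det _).1 hU)]

end Scaling

/-! ## §2 The `k`-uniform constants and [6] (5.6) for the print-normalized operator from the row-restricted inputs -/

section Gen

/-- **the `k`-UNIFORM (5.6) coercivity constant of `Δ^{print}_{k,loc}(u) + κ′P(u_k)`**: `γ_P = c240(γ₀, κ′)(1 − σ) − E₅₆`,
`γ₀ = min(a/(9(d′+1)), 1/12)` (`gamma56 = (A/a_k)·γ_P`). [cite: BalabanImbrieJaffe1988, (2.38), (2.40) p.264] -/
def gammaP (P : Params) (a : ℝ) (k : ℕ) (θ c₀ δ₀ : ℝ) (m : ℕ) (R R₁ σ κ' : ℝ) : ℝ :=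
  c240 P (min (a / (9 * ((P.d : ℝ) + 1))) (1 / 12)) κ' * (1 - σ) - E56 P a k θ c₀ δ₀ m R R₁

/-- **the `k`-UNIFORM (5.6) kernel constant of `Δ^{print}_{k,loc}(u) + κ′P(u_k)`**: `c_P = a_k(1 + m·a_kc₀e^{δ₀}) + κ′L^{−2d′}e^{δ₀(L−1)}`
(`c56 = (A/a_k)·c_P`). [cite: BalabanImbrieJaffe1988, (2.36), (2.40) p.264] -/
def cP (P : Params) (a : ℝ) (k : ℕ) (c₀ δ₀ : ℝ) (m : ℕ) (κ' : ℝ) : ℝ :=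
  B1.aSeq a P.L k * (1 + m * B1.aSeq a P.L k * (c₀ * Real.exp δ₀)) + κ' * (((P.L : ℝ) ^ P.d)⁻¹) ^ 2 * Real.exp (δ₀ * ((P.L : ℝ) - 1))

/-- `γ₅₆ = (A/a_k)·γ_P`. [cite: BalabanImbrieJaffe1988, (2.40) p.264] -/
theorem gamma56_eq (P : Params) (a : ℝ) (k : ℕ) (θ c₀ δ₀ : ℝ) (m : ℕ) (R R₁ σ κ' : ℝ) :
    gamma56 P a k θ c₀ δ₀ m R R₁ σ κ' =
      (B1RG242Torus.α P a k * (P.L : ℝ) ^ (k * P.d)) / B1.aSeq a P.L k * gammaP P a k θ c₀ δ₀ m R R₁ σ κ' := rfl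

/-- **[6] (5.6) WITH `k`-UNIFORM CONSTANTS AND INVERTIBILITY FOR THE PRINT-NORMALIZED `(Δ^{print}_{k,loc}(u) + κ′P(u_k))|_Λ`,
`Δ^{print}_{k,loc}(u) = (a_k/A)·deltaLocT A ε⁻¹ u k …`, FROM THE ROW-RESTRICTED INPUTS** (hypotheses = gen 23's `hyp56_deltaLocT_gen`):
`0 < γ_P`, `0 ≤ c_P`, `B4.Hyp56 Λ′ (reOp Λ (Δ^{print}_{k,loc}(u) + κ′P(u_k))) γ_P c_P δ₀`, `(…)|_Λ` invertible — gen 23's theorem rescaled by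
`a_k/A` (`hyp56_smul`, `reOp_smul`, `op240_smul_of_mul_eq`). [cite: BalabanImbrieJaffe1988, (2.40) p.264] [cite: Balaban1983RegularityDecay, (5.6) p.594] -/
theorem hyp56_printNorm_gen {k : ℕ} (hk1 : 1 ≤ k) (hk' : 0 + k + 1 ≤ P.m + P.K) {a : ℝ} (ha : 0 < a) (U : GaugeField P 0 U1) {θ : ℝ}
    (hθ : ∀ (x : Balaban1983to89.Site P 0) (μ ν : Fin P.d), ‖plaqC U x μ ν - 1‖ ≤ θ)
    {Ω : Finset (Balaban1983to89.Site P 0)} (hΩ : IsBlockUnion k Ω) (X₀ : Finset (Balaban1983to89.Site P 0)) {ι : Type*} [Fintype ι]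
    {cube : ι → Finset (Balaban1983to89.Site P 0)} (hcube : ∀ α, IsBlockUnion k (cube α)) (Xr : ι → Finset (Balaban1983to89.Site P 0))
    {lam : ι → Balaban1983to89.Site P 0 → Balaban1983to89.Site P 0 → ℝ} {ζ'' : Balaban1983to89.Site P 0 → Balaban1983to89.Site P 0 → ℝ}
    (hlam : ∀ x y, ∑ α, |lam α x y| ≤ 1) (hlamsymm : ∀ α x₁ x₂, lam α x₂ x₁ = lam α x₁ x₂) (hζ : ∀ x y, 0 ≤ ζ'' x y ∧ ζ'' x y ≤ 1)
    (hζsymm : ∀ x₁ x₂, ζ'' x₂ x₁ = ζ'' x₁ x₂) {δ₀ c₀ : ℝ} (hδ₀ : 0 < δ₀) (hc₀ : 0 ≤ c₀)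
    (hGΩ : ∀ x ∈ X₀, ∀ (f : Balaban1983to89.Site P 0 → ℂ) (F D : ℝ), (∀ y, ‖f y‖ ≤ F) → 0 ≤ D →
      (∀ y, f y ≠ 0 → D ≤ B5Ineq137Torus.T P 0 x y) →
      ‖(gBox (B1RG242Torus.α P a k * (P.L : ℝ) ^ (k * P.d)) P.eps⁻¹ U k Ω *ᵥ f) x‖ ≤
        P.spacing k ^ 2 * (c₀ * Real.exp (-(δ₀ * (((P.L : ℝ) ^ k)⁻¹ * D))) * F))
    (hG : ∀ α, ∀ x ∈ Xr α, ∀ (f : Balaban1983to89.Site P 0 → ℂ) (F D : ℝ), (∀ y, ‖f y‖ ≤ F) → 0 ≤ D →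
      (∀ y, f y ≠ 0 → D ≤ B5Ineq137Torus.T P 0 x y) →
      ‖(gBox (B1RG242Torus.α P a k * (P.L : ℝ) ^ (k * P.d)) P.eps⁻¹ U k (cube α) *ᵥ f) x‖ ≤
        P.spacing k ^ 2 * (c₀ * Real.exp (-(δ₀ * (((P.L : ℝ) ^ k)⁻¹ * D))) * F))
    (hC : ∀ α, ∀ x ∈ Xr α, ∀ (f : Balaban1983to89.Site P 0 → ℂ) (F D Db Df : ℝ), (∀ y, ‖f y‖ ≤ F) → (∀ y, y ∉ cube α → f y = 0) →
      0 ≤ D → (∀ y, f y ≠ 0 → D ≤ B5Ineq137Torus.T P 0 x y) → 0 ≤ Db → (∀ w, w ∉ cube α → Db ≤ B5Ineq137Torus.T P 0 x w) →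
      0 ≤ Df → (∀ y, f y ≠ 0 → ∀ w, w ∉ cube α → Df ≤ B5Ineq137Torus.T P 0 y w) →
      ‖(gBox (B1RG242Torus.α P a k * (P.L : ℝ) ^ (k * P.d)) P.eps⁻¹ U k (cube α) *ᵥ f) x -
          (gBox (B1RG242Torus.α P a k * (P.L : ℝ) ^ (k * P.d)) P.eps⁻¹ U k Ω *ᵥ f) x‖ ≤
        P.spacing k ^ 2 * (c₀ * Real.exp (-(δ₀ * (((P.L : ℝ) ^ k)⁻¹ * D))) * Real.exp (-(δ₀ * (((P.L : ℝ) ^ k)⁻¹ * (Db + Df)))) * F))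
    {R R₁ : ℝ} (hR : 0 ≤ R) (m : ℕ) (Λ : Finset (Balaban1983to89.Site P (0 + k)))
    (hrows : ∀ y₁ ∈ Λ,
      (∀ x ∈ blockK k y₁, x ∈ X₀) ∧
      (∀ x ∈ blockK k y₁, ∀ y, ζ'' x y ≠ 0 → ∑ α, lam α x y = 1) ∧
      (∀ x ∈ blockK k y₁, ∀ α y, ζ'' x y * lam α x y ≠ 0 → x ∈ Xr α ∧ y ∈ cube α ∧
          ∀ w, w ∉ cube α → R ≤ B5Ineq137Torus.T P 0 x w ∧ R ≤ B5Ineq137Torus.T P 0 y w) ∧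
      (∀ x ∈ blockK k y₁, ∀ y, B5Ineq137Torus.T P 0 x y ≤ R₁ → ζ'' x y = 1) ∧
      ∃ S : Finset ι, S.card ≤ m ∧ ∀ x ∈ blockK k y₁, ∀ α y, ζ'' x y * lam α x y ≠ 0 → α ∈ S)
    (hΛ : ∀ b : PBond P (0 + k), (b.src ∈ Λ ∨ b.tgt ∈ Λ) → b ∈ starB (innerK k Ω))
    (hhalfΛ : ∀ y₁ ∈ Λ, ∀ y₂ ∈ Λ, cdist y₁ y₂ ≤ B5Ineq137Torus.T P (0 + k) y₁ y₂)
    {T₁ δ₁ σ : ℝ} (hInt : ∀ b : PBond P (0 + k), blkIter 1 b.src = blkIter 1 b.tgt → ‖toC (lineIter U k b) - 1‖ ≤ T₁)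
    (hTree : ∀ y : Balaban1983to89.Site P (0 + k), ‖holCK (lineIter U k) 1 y - 1‖ ≤ δ₁)
    (hσ : 2 * (((P.L : ℝ) - 1) * P.L) * P.d * T₁ ^ 2 + 2 * δ₁ ^ 2 ≤ σ) {κ' : ℝ} (hκ' : 0 ≤ κ')
    (hE : E56 P a k θ c₀ δ₀ m R R₁ < c240 P (min (a / (9 * ((P.d : ℝ) + 1))) (1 / 12)) κ' * (1 - σ)) :
    0 < gammaP P a k θ c₀ δ₀ m R R₁ σ κ' ∧ 0 ≤ cP P a k c₀ δ₀ m κ' ∧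
    B4.Hyp56 (chartSet Λ)
        (reOp Λ (op240 ((((B1.aSeq a P.L k / (B1RG242Torus.α P a k * (P.L : ℝ) ^ (k * P.d))) : ℝ) : ℂ) • deltaLocT (B1RG242Torus.α P a k * (P.L : ℝ) ^ (k * P.d)) P.eps⁻¹ U k cube lam ζ'') κ' (lineIter U k)))
        (gammaP P a k θ c₀ δ₀ m R R₁ σ κ') (cP P a k c₀ δ₀ m κ') δ₀ ∧
      IsUnit (compress Λ (op240 ((((B1.aSeq a P.L k / (B1RG242Torus.α P a k * (P.L : ℝ) ^ (k * P.d))) : ℝ) : ℂ) • deltaLocT (B1RG242Torus.α P a k * (P.L : ℝ) ^ (k * P.d)) P.eps⁻¹ U k cube lam ζ'') κ' (lineIter U k))) := by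
  obtain ⟨hγ, hc, h56, hU⟩ := hyp56_deltaLocT_gen hk1 hk' ha U hθ hΩ X₀ hcube Xr hlam hlamsymm hζ hζsymm hδ₀ hc₀ hGΩ hG hC hR m Λ hrows hΛ
    hhalfΛ hInt hTree hσ hκ' hE
  set A : ℝ := B1RG242Torus.α P a k * (P.L : ℝ) ^ (k * P.d) with hAdef
  set ak : ℝ := B1.aSeq a P.L k with hakdef
  have hak : 0 < ak := B1.aSeq_pos ha (B1RG242Torus.one_lt_cast_L P) hk1
  have hα : 0 < B1RG242Torus.α P a k := mul_pos hak (inv_pos.mpr (pow_pos (P.spacing_pos k) 2))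
  have hA0 : 0 < A := mul_pos hα (pow_pos P.cast_L_pos _)
  have hr : 0 < ak / A := div_pos hak hA0
  have e1 : ak / A * A = ak := div_mul_cancel₀ ak hA0.ne'
  have e2 : ak / A * (A / ak) = 1 := by rw [div_mul_div_comm, mul_comm ak A, div_self (mul_ne_zero hA0.ne' hak.ne')]
  have hmul : ak / A * (A / ak * κ') = κ' := by rw [← mul_assoc, e2, one_mul]
  have hγP : ak / A * gamma56 P a k θ c₀ δ₀ m R R₁ σ κ' = gammaP P a k θ c₀ δ₀ m R R₁ σ κ' := by
    rw [gamma56_eq, ← hAdef, ← hakdef, ← mul_assoc, e2, one_mul]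
  have hcP : ak / A * c56 P a k c₀ δ₀ m κ' = cP P a k c₀ δ₀ m κ' := by
    unfold c56 cP
    rw [← hAdef, ← hakdef]
    linear_combination (1 + (m : ℝ) * ak * (c₀ * Real.exp δ₀)) * e1 +
      (κ' * (((P.L : ℝ) ^ P.d)⁻¹) ^ 2 * Real.exp (δ₀ * ((P.L : ℝ) - 1))) * e2
  have h' := hyp56_smul hr.le h56
  rw [hγP, hcP, ← reOp_smul, ← op240_smul_of_mul_eq _ _ hmul] at h'
  refine ⟨?_, ?_, h', ?_⟩
  · rw [← hγP]; exact mul_pos hr hγ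
  · rw [← hcP]; exact mul_nonneg hr.le hc
  · rw [op240_smul_of_mul_eq _ _ hmul]
    exact isUnit_compress_smul hU hr.ne'

end Gen

/-! ## §3 THE MEMBERS FOR THE PRINTED TORUS DATA at the `k`-uniform constants `(γ_P, c_P, δ₀)` -/

section TorusData

variable {d : ℕ}

/-- **[6] (5.6) WITH `k`-UNIFORM CONSTANTS + (2.40)-INVERTIBILITY FOR THE PRINT-NORMALIZED `(Δ^{print}_{k,loc}(u) + κ′P(u_k))|_Λ`, `Ω = T_η`, AT
A GENERAL SMALL-PLAQUETTE BACKGROUND, FOR THE PRINTED TORUS DATA** (binder list = gen 23's `hyp56_deltaLocT_smallPlaquette_torus_cwt`):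
`0 < γ_P ∧ 0 ≤ c_P ∧ B4.Hyp56 Λ′ (reOp Λ ·) γ_P c_P δ₀ ∧ IsUnit ((·)|_Λ)` with `m = (⌊(L^k − 1 + R₀)/s_g⌋ + 3)^{d′}` — §2 on gen 22's inputs.
[cite: BalabanImbrieJaffe1988, (2.40) p.264] [cite: Balaban1983RegularityDecay, (5.6) p.594] -/
theorem hyp56_printNorm_smallPlaquette_torus_cwt (d ℓ : ℕ) (hd1 : 1 ≤ d) (hd3 : d + 1 ≤ 3) (hℓ : 1 ≤ ℓ) (hodd : Odd (ℓ + 1)) {a : ℝ}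
    (ha : 0 < a) :
    ∃ δ₀ c₀ : ℝ, 0 < δ₀ ∧ 0 < c₀ ∧ ∀ (P : Params) (hPd : P.d = d + 1), P.L = ℓ + 1 →
      ∀ (k : ℕ), 1 ≤ k → k ≤ P.K → k + 1 ≤ P.m + P.K → 2 * (P.L ^ k - 1) + 4 < P.sitesPerDir 0 →
      ∀ (U : GaugeField P 0 U1) (θ : ℝ), 0 ≤ θ → (∀ (y : Balaban1983to89.Site P 0) (μ ν : Fin P.d), ‖plaqC U y μ ν - 1‖ ≤ θ) →
        (((P.L : ℝ) ^ k) ^ 2 * θ) ^ 2 ≤ 1 / 500 →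
      ∀ (c M0 : Fin (d + 1) → ℕ), (∀ i, 1 ≤ M0 i) → (∀ i, c i * P.L ^ k + P.L ^ k * M0 i ≤ P.sitesPerDir 0) →
        (∀ i, 2 * (P.L ^ k * M0 i) ≤ P.sitesPerDir 0) →
      ∀ (sg W : ℕ), 1 ≤ sg → ∀ (R R₀ R₁ : ℝ), 10 * (P.L : ℝ) ^ k < R → 0 ≤ R₁ → R₁ < R₀ →
        2 * (sg : ℝ) / 3 + R₀ / 2 + R ≤ W → (∀ i, ((P.L ^ k * M0 i : ℕ) : ℝ) + R ≤ P.sitesPerDir 0) →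
      ∀ (Λ : Finset (Balaban1983to89.Site P (0 + k))),
        (∀ y₁ ∈ Λ, ∀ μ, (c (Fin.cast hPd μ) : ℝ) * P.L ^ k + (R₀ + R) ≤ (P.L : ℝ) ^ k * (y₁ μ).val ∧
          (P.L : ℝ) ^ k * (y₁ μ).val + P.L ^ k + (R₀ + R) ≤ (c (Fin.cast hPd μ) : ℝ) * P.L ^ k + (P.L : ℝ) ^ k * M0 (Fin.cast hPd μ)) →
      ∀ (T₁ δ' σ : ℝ),
        (∀ b : PBond P (0 + k), blkIter 1 b.src = blkIter 1 b.tgt → ‖toC (lineIter U k b) - 1‖ ≤ T₁) →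
        (∀ y : Balaban1983to89.Site P (0 + k), ‖holCK (lineIter U k) 1 y - 1‖ ≤ δ') →
        2 * (((P.L : ℝ) - 1) * P.L) * P.d * T₁ ^ 2 + 2 * δ' ^ 2 ≤ σ →
      ∀ (κ' : ℝ), 0 ≤ κ' →
        4 / 3 * (P.d : ℝ) ^ 4 * (((P.L : ℝ) ^ k) ^ 2 * θ) ^ 2 +
            B1.aSeq a P.L k ^ 2 * (c₀ * Real.exp (δ₀ / 2) * latticeConst P.d (δ₀ / 2)) *
              (((⌊(((P.L : ℝ) ^ k) - 1 + R₀) / sg⌋₊ : ℝ) + 3) ^ (d + 1) *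
                  Real.exp (-(δ₀ * (((P.L : ℝ) ^ k)⁻¹ * (2 * R)))) +
                Real.exp (-(δ₀ / 2 * (((P.L : ℝ) ^ k)⁻¹ * R₁)))) <
          c240 P (min (a / (9 * (P.d + 1))) (1 / 12)) κ' * (1 - σ) →
      0 < gammaP P a k θ c₀ δ₀ ((⌊(((P.L : ℝ) ^ k) - 1 + R₀) / sg⌋₊ + 3) ^ (d + 1)) R R₁ σ κ' ∧
      0 ≤ cP P a k c₀ δ₀ ((⌊(((P.L : ℝ) ^ k) - 1 + R₀) / sg⌋₊ + 3) ^ (d + 1)) κ' ∧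
      B4.Hyp56 (chartSet Λ)
          (reOp Λ (op240
            ((((B1.aSeq a P.L k / (B1RG242Torus.α P a k * (P.L : ℝ) ^ (k * P.d))) : ℝ) : ℂ) •
              deltaLocT (B1RG242Torus.α P a k * (P.L : ℝ) ^ (k * P.d)) P.eps⁻¹ U k (cubeFam hPd (P.L ^ k) c M0 sg W) (lamFam hPd (P.L ^ k) c M0 sg)
                (cutoff R₁ R₀ (B5Ineq137Torus.T P 0)))
            κ' (lineIter U k)))
          (gammaP P a k θ c₀ δ₀ ((⌊(((P.L : ℝ) ^ k) - 1 + R₀) / sg⌋₊ + 3) ^ (d + 1)) R R₁ σ κ') (cP P a k c₀ δ₀ ((⌊(((P.L : ℝ) ^ k) - 1 + R₀) / sg⌋₊ + 3) ^ (d + 1)) κ') δ₀ ∧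
      IsUnit (compress Λ (op240
            ((((B1.aSeq a P.L k / (B1RG242Torus.α P a k * (P.L : ℝ) ^ (k * P.d))) : ℝ) : ℂ) •
              deltaLocT (B1RG242Torus.α P a k * (P.L : ℝ) ^ (k * P.d)) P.eps⁻¹ U k (cubeFam hPd (P.L ^ k) c M0 sg W) (lamFam hPd (P.L ^ k) c M0 sg)
                (cutoff R₁ R₀ (B5Ineq137Torus.T P 0)))
            κ' (lineIter U k))) := by
  obtain ⟨δ₀, c₀, hδ₀, hc₀, I⟩ := inputs_smallPlaquette d ℓ hd1 hd3 hℓ hodd ha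
  refine ⟨δ₀, c₀, hδ₀, hc₀, ?_⟩
  intro P hPd hPL k hk1 hkK hk' hbig U θ hθ0 hθ hτ c M0 hM0 hfit0 hhalf sg W hsg R R₀ R₁ hRm hR₁ hR10 hW hgap Λ hΛ T₁ δ' σ hInt hTree hσ κ' hκ' hE
  have hN0 : ∀ i, P.L ^ k * M0 i < P.sitesPerDir 0 := fun i => by
    have h1 : 0 < P.L ^ k * M0 i := Nat.mul_pos (pow_pos P.L_pos k) (hM0 i)
    have h2 := hhalf i
    omega
  obtain ⟨I1, I2, I3⟩ := I P hPd hPL hk1 hkK hbig U hθ0 hθ hτ hM0 hfit0 hN0 sg W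
  have hkm : k ≤ P.m + P.K := hkK.trans (Nat.le_add_left _ _)
  have hk : 0 + k ≤ P.m + P.K := by omega
  have hn : 1 ≤ P.L ^ k := Nat.one_le_pow _ _ P.L_pos
  have hPk : (0 : ℝ) < (P.L : ℝ) ^ k := pow_pos P.cast_L_pos k
  have hR : 0 ≤ R := le_trans (by positivity) hRm.le
  have hR₀ : 0 ≤ R₀ := hR₁.trans hR10.le
  have hk'' : 0 + k + 1 ≤ P.m + P.K := by omega
  have hcubeBU : ∀ α : ↥(BIJ88LocWeights227Torus.labels (P.L ^ k) M0 sg), IsBlockUnion k (cubeFam hPd (P.L ^ k) c M0 sg W α) := fun α => by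
    obtain ⟨c', M, hM, hfit', -, e⟩ := cubeFam_fits (hPd := hPd) (s := sg) (W := W) hM0 hfit0 hN0 α
    rw [e]; exact isBlockUnion_cubeT hPd hkm rfl hfit'
  have hhalfΛ : ∀ y₁ ∈ Λ, ∀ y₂ ∈ Λ, cdist y₁ y₂ ≤ B5Ineq137Torus.T P (0 + k) y₁ y₂ := fun y₁ hy₁ y₂ hy₂ =>
    cdist_le_T_of_two_mul_abs_le (two_mul_abs_sub_le_of_deep hPd hk (by linarith : 0 ≤ R₀ + R) hhalf (hΛ y₁ hy₁) (hΛ y₂ hy₂))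
  have h := hyp56_printNorm_gen hk1 hk'' ha U hθ (isBlockUnion_univ k) univ (cube := cubeFam hPd (P.L ^ k) c M0 sg W) hcubeBU
    (fun α => deepRows (10 * (P.L : ℝ) ^ k) (cubeFam hPd (P.L ^ k) c M0 sg W α))
    (lam := lamFam hPd (P.L ^ k) c M0 sg) (ζ'' := cutoff R₁ R₀ (B5Ineq137Torus.T P 0))
    (sum_abs_lamT_le_one hfit0) (fun α x₁ x₂ => lamFam_symm hPd (P.L ^ k) c M0 sg α x₁ x₂) (cutoff_mem_unitInterval R₁ R₀)
    (cutoff_T_symm R₁ R₀) hδ₀ hc₀.le I1 I2 I3 hR ((⌊(((P.L : ℝ) ^ k) - 1 + R₀) / sg⌋₊ + 3) ^ (d + 1)) Λ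
    (fun y₁ hy₁ => rows_of_deep hPd hk hn hsg hfit0 hR hR₁ hR10 hRm hgap hW (hΛ y₁ hy₁))
    (fun b _ => by rw [starB_innerK_univ]; exact mem_univ _) hhalfΛ hInt hTree hσ hκ'
    (by simp only [E56]; push_cast at hE ⊢; exact hE)
  exact h

/-- **(2.42) FOR THE PRINT-NORMALIZED `C^{(k)}_Λ(u) = [(Δ^{print}_{k,loc}(u) + κ′P(u_k))|_Λ]^{−1}`, PRINTED TORUS DATA, `k`-UNIFORM CUBE
CONDITIONS** (*"C^{(k)}_Λ(u; x₁, x₂) = Σ_ω C^{(k)}_{Λ,ω}(u, x₁, x₂), (2.42) where ω is a walk on a lattice of spacing M = O(1)"*): for `M ≥ 5`,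
`M > K_R(γ_P, c_P, δ₀)`, `M > Θ₁(γ_P, c_P, δ₀)`: the unconditional `HasSum` in `ℂ` over all walks — gen 23's `hasSum_walkTerms_inv`.
[cite: BalabanImbrieJaffe1988, (2.42) p.264] -/
theorem eq242_printNorm_smallPlaquette_torus_cwt (d ℓ : ℕ) (hd1 : 1 ≤ d) (hd3 : d + 1 ≤ 3) (hℓ : 1 ≤ ℓ) (hodd : Odd (ℓ + 1)) {a : ℝ}
    (ha : 0 < a) :
    ∃ δ₀ c₀ : ℝ, 0 < δ₀ ∧ 0 < c₀ ∧ ∀ (P : Params) (hPd : P.d = d + 1), P.L = ℓ + 1 →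
      ∀ (k : ℕ), 1 ≤ k → k ≤ P.K → k + 1 ≤ P.m + P.K → 2 * (P.L ^ k - 1) + 4 < P.sitesPerDir 0 →
      ∀ (U : GaugeField P 0 U1) (θ : ℝ), 0 ≤ θ → (∀ (y : Balaban1983to89.Site P 0) (μ ν : Fin P.d), ‖plaqC U y μ ν - 1‖ ≤ θ) →
        (((P.L : ℝ) ^ k) ^ 2 * θ) ^ 2 ≤ 1 / 500 →
      ∀ (c M0 : Fin (d + 1) → ℕ), (∀ i, 1 ≤ M0 i) → (∀ i, c i * P.L ^ k + P.L ^ k * M0 i ≤ P.sitesPerDir 0) →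
        (∀ i, 2 * (P.L ^ k * M0 i) ≤ P.sitesPerDir 0) →
      ∀ (sg W : ℕ), 1 ≤ sg → ∀ (R R₀ R₁ : ℝ), 10 * (P.L : ℝ) ^ k < R → 0 ≤ R₁ → R₁ < R₀ →
        2 * (sg : ℝ) / 3 + R₀ / 2 + R ≤ W → (∀ i, ((P.L ^ k * M0 i : ℕ) : ℝ) + R ≤ P.sitesPerDir 0) →
      ∀ (Λ : Finset (Balaban1983to89.Site P (0 + k))),
        (∀ y₁ ∈ Λ, ∀ μ, (c (Fin.cast hPd μ) : ℝ) * P.L ^ k + (R₀ + R) ≤ (P.L : ℝ) ^ k * (y₁ μ).val ∧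
          (P.L : ℝ) ^ k * (y₁ μ).val + P.L ^ k + (R₀ + R) ≤ (c (Fin.cast hPd μ) : ℝ) * P.L ^ k + (P.L : ℝ) ^ k * M0 (Fin.cast hPd μ)) →
      ∀ (T₁ δ' σ : ℝ),
        (∀ b : PBond P (0 + k), blkIter 1 b.src = blkIter 1 b.tgt → ‖toC (lineIter U k b) - 1‖ ≤ T₁) →
        (∀ y : Balaban1983to89.Site P (0 + k), ‖holCK (lineIter U k) 1 y - 1‖ ≤ δ') →
        2 * (((P.L : ℝ) - 1) * P.L) * P.d * T₁ ^ 2 + 2 * δ' ^ 2 ≤ σ →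
      ∀ (κ' : ℝ), 0 ≤ κ' →
        4 / 3 * (P.d : ℝ) ^ 4 * (((P.L : ℝ) ^ k) ^ 2 * θ) ^ 2 +
            B1.aSeq a P.L k ^ 2 * (c₀ * Real.exp (δ₀ / 2) * latticeConst P.d (δ₀ / 2)) *
              (((⌊(((P.L : ℝ) ^ k) - 1 + R₀) / sg⌋₊ : ℝ) + 3) ^ (d + 1) *
                  Real.exp (-(δ₀ * (((P.L : ℝ) ^ k)⁻¹ * (2 * R)))) +
                Real.exp (-(δ₀ / 2 * (((P.L : ℝ) ^ k)⁻¹ * R₁)))) <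
          c240 P (min (a / (9 * (P.d + 1))) (1 / 12)) κ' * (1 - σ) →
      ∀ (M : ℕ), 5 ≤ M → kR P.d 2 (gammaP P a k θ c₀ δ₀ ((⌊(((P.L : ℝ) ^ k) - 1 + R₀) / sg⌋₊ + 3) ^ (d + 1)) R R₁ σ κ') (cP P a k c₀ δ₀ ((⌊(((P.L : ℝ) ^ k) - 1 + R₀) / sg⌋₊ + 3) ^ (d + 1)) κ') δ₀ < M →
        thetaConst P.d 2 (gammaP P a k θ c₀ δ₀ ((⌊(((P.L : ℝ) ^ k) - 1 + R₀) / sg⌋₊ + 3) ^ (d + 1)) R R₁ σ κ') (cP P a k c₀ δ₀ ((⌊(((P.L : ℝ) ^ k) - 1 + R₀) / sg⌋₊ + 3) ^ (d + 1)) κ') δ₀ < M →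
      ∀ (x₁ x₂ : ↥Λ),
        HasSum (fun ω : Walk ↥(B4Sect5CubeBounds.labels M (chartSet Λ)) =>
            (⟨latticeCw M (chartSet Λ) 2
                  (reOp Λ (op240
            ((((B1.aSeq a P.L k / (B1RG242Torus.α P a k * (P.L : ℝ) ^ (k * P.d))) : ℝ) : ℂ) •
              deltaLocT (B1RG242Torus.α P a k * (P.L : ℝ) ^ (k * P.d)) P.eps⁻¹ U k (cubeFam hPd (P.L ^ k) c M0 sg W) (lamFam hPd (P.L ^ k) c M0 sg)
                (cutoff R₁ R₀ (B5Ineq137Torus.T P 0)))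
            κ' (lineIter U k))) ω (idxEquiv Λ (x₁, 0)) (idxEquiv Λ (x₂, 0)),
              latticeCw M (chartSet Λ) 2
                  (reOp Λ (op240
            ((((B1.aSeq a P.L k / (B1RG242Torus.α P a k * (P.L : ℝ) ^ (k * P.d))) : ℝ) : ℂ) •
              deltaLocT (B1RG242Torus.α P a k * (P.L : ℝ) ^ (k * P.d)) P.eps⁻¹ U k (cubeFam hPd (P.L ^ k) c M0 sg W) (lamFam hPd (P.L ^ k) c M0 sg)
                (cutoff R₁ R₀ (B5Ineq137Torus.T P 0)))
            κ' (lineIter U k))) ω (idxEquiv Λ (x₁, 1)) (idxEquiv Λ (x₂, 0))⟩ : ℂ))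
          ((compress Λ (op240
            ((((B1.aSeq a P.L k / (B1RG242Torus.α P a k * (P.L : ℝ) ^ (k * P.d))) : ℝ) : ℂ) •
              deltaLocT (B1RG242Torus.α P a k * (P.L : ℝ) ^ (k * P.d)) P.eps⁻¹ U k (cubeFam hPd (P.L ^ k) c M0 sg W) (lamFam hPd (P.L ^ k) c M0 sg)
                (cutoff R₁ R₀ (B5Ineq137Torus.T P 0)))
            κ' (lineIter U k)))⁻¹ x₁ x₂) := by
  obtain ⟨δ₀, c₀, hδ₀, hc₀, H⟩ := hyp56_printNorm_smallPlaquette_torus_cwt d ℓ hd1 hd3 hℓ hodd ha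
  refine ⟨δ₀, c₀, hδ₀, hc₀, ?_⟩
  intro P hPd hPL k hk1 hkK hk' hbig U θ hθ0 hθ hτ c M0 hM0 hfit0 hhalf sg W hsg R R₀ R₁ hRm hR₁ hR10 hW hgap Λ hΛ T₁ δ' σ hInt hTree hσ κ' hκ' hE M hM hMR hMθ x₁ x₂
  obtain ⟨hγ, hc, hA, hU⟩ := H P hPd hPL k hk1 hkK hk' hbig U θ hθ0 hθ hτ c M0 hM0 hfit0 hhalf sg W hsg R R₀ R₁ hRm hR₁ hR10 hW hgap Λ hΛ T₁ δ' σ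
    hInt hTree hσ κ' hκ' hE
  exact hasSum_walkTerms_inv hγ hc hδ₀ hA hU hM hMR hMθ x₁ x₂

/-- **(2.45) FOR THE PRINT-NORMALIZED `C^{(k)}_Λ(u)`, PRINTED TORUS DATA, `k`-UNIFORM CUBE CONDITIONS** (typed `Eq245` for the realified
entries; every `ρ`, `s`) — gen 23's `eq245_realify_inv`. [cite: BalabanImbrieJaffe1988, (2.45) p.264] -/
theorem eq245_printNorm_smallPlaquette_torus_cwt (d ℓ : ℕ) (hd1 : 1 ≤ d) (hd3 : d + 1 ≤ 3) (hℓ : 1 ≤ ℓ) (hodd : Odd (ℓ + 1)) {a : ℝ}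
    (ha : 0 < a) :
    ∃ δ₀ c₀ : ℝ, 0 < δ₀ ∧ 0 < c₀ ∧ ∀ (P : Params) (hPd : P.d = d + 1), P.L = ℓ + 1 →
      ∀ (k : ℕ), 1 ≤ k → k ≤ P.K → k + 1 ≤ P.m + P.K → 2 * (P.L ^ k - 1) + 4 < P.sitesPerDir 0 →
      ∀ (U : GaugeField P 0 U1) (θ : ℝ), 0 ≤ θ → (∀ (y : Balaban1983to89.Site P 0) (μ ν : Fin P.d), ‖plaqC U y μ ν - 1‖ ≤ θ) →
        (((P.L : ℝ) ^ k) ^ 2 * θ) ^ 2 ≤ 1 / 500 →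
      ∀ (c M0 : Fin (d + 1) → ℕ), (∀ i, 1 ≤ M0 i) → (∀ i, c i * P.L ^ k + P.L ^ k * M0 i ≤ P.sitesPerDir 0) →
        (∀ i, 2 * (P.L ^ k * M0 i) ≤ P.sitesPerDir 0) →
      ∀ (sg W : ℕ), 1 ≤ sg → ∀ (R R₀ R₁ : ℝ), 10 * (P.L : ℝ) ^ k < R → 0 ≤ R₁ → R₁ < R₀ →
        2 * (sg : ℝ) / 3 + R₀ / 2 + R ≤ W → (∀ i, ((P.L ^ k * M0 i : ℕ) : ℝ) + R ≤ P.sitesPerDir 0) →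
      ∀ (Λ : Finset (Balaban1983to89.Site P (0 + k))),
        (∀ y₁ ∈ Λ, ∀ μ, (c (Fin.cast hPd μ) : ℝ) * P.L ^ k + (R₀ + R) ≤ (P.L : ℝ) ^ k * (y₁ μ).val ∧
          (P.L : ℝ) ^ k * (y₁ μ).val + P.L ^ k + (R₀ + R) ≤ (c (Fin.cast hPd μ) : ℝ) * P.L ^ k + (P.L : ℝ) ^ k * M0 (Fin.cast hPd μ)) →
      ∀ (T₁ δ' σ : ℝ),
        (∀ b : PBond P (0 + k), blkIter 1 b.src = blkIter 1 b.tgt → ‖toC (lineIter U k b) - 1‖ ≤ T₁) →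
        (∀ y : Balaban1983to89.Site P (0 + k), ‖holCK (lineIter U k) 1 y - 1‖ ≤ δ') →
        2 * (((P.L : ℝ) - 1) * P.L) * P.d * T₁ ^ 2 + 2 * δ' ^ 2 ≤ σ →
      ∀ (κ' : ℝ), 0 ≤ κ' →
        4 / 3 * (P.d : ℝ) ^ 4 * (((P.L : ℝ) ^ k) ^ 2 * θ) ^ 2 +
            B1.aSeq a P.L k ^ 2 * (c₀ * Real.exp (δ₀ / 2) * latticeConst P.d (δ₀ / 2)) *
              (((⌊(((P.L : ℝ) ^ k) - 1 + R₀) / sg⌋₊ : ℝ) + 3) ^ (d + 1) *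
                  Real.exp (-(δ₀ * (((P.L : ℝ) ^ k)⁻¹ * (2 * R)))) +
                Real.exp (-(δ₀ / 2 * (((P.L : ℝ) ^ k)⁻¹ * R₁)))) <
          c240 P (min (a / (9 * (P.d + 1))) (1 / 12)) κ' * (1 - σ) →
      ∀ (M : ℕ), 5 ≤ M → kR P.d 2 (gammaP P a k θ c₀ δ₀ ((⌊(((P.L : ℝ) ^ k) - 1 + R₀) / sg⌋₊ + 3) ^ (d + 1)) R R₁ σ κ') (cP P a k c₀ δ₀ ((⌊(((P.L : ℝ) ^ k) - 1 + R₀) / sg⌋₊ + 3) ^ (d + 1)) κ') δ₀ < M →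
        thetaConst P.d 2 (gammaP P a k θ c₀ δ₀ ((⌊(((P.L : ℝ) ^ k) - 1 + R₀) / sg⌋₊ + 3) ^ (d + 1)) R R₁ σ κ') (cP P a k c₀ δ₀ ((⌊(((P.L : ℝ) ^ k) - 1 + R₀) / sg⌋₊ + 3) ^ (d + 1)) κ') δ₀ < M →
      ∀ (ρ : ℝ) (s : ℕ),
        BIJ88Sect2Statements.Eq245
          (fun p q : ↥Λ × Fin 2 => realify (compress Λ (op240
            ((((B1.aSeq a P.L k / (B1RG242Torus.α P a k * (P.L : ℝ) ^ (k * P.d))) : ℝ) : ℂ) •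
              deltaLocT (B1RG242Torus.α P a k * (P.L : ℝ) ^ (k * P.d)) P.eps⁻¹ U k (cubeFam hPd (P.L ^ k) c M0 sg W) (lamFam hPd (P.L ^ k) c M0 sg)
                (cutoff R₁ R₀ (B5Ineq137Torus.T P 0)))
            κ' (lineIter U k)))⁻¹ p q)
          (fun p q => cLoc (ldist (N := 2) M) ρ (fun ω y₁ y₂ => latticeCw M (chartSet Λ) 2
              (reOp Λ (op240
            ((((B1.aSeq a P.L k / (B1RG242Torus.α P a k * (P.L : ℝ) ^ (k * P.d))) : ℝ) : ℂ) •
              deltaLocT (B1RG242Torus.α P a k * (P.L : ℝ) ^ (k * P.d)) P.eps⁻¹ U k (cubeFam hPd (P.L ^ k) c M0 sg W) (lamFam hPd (P.L ^ k) c M0 sg)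
                (cutoff R₁ R₀ (B5Ineq137Torus.T P 0)))
            κ' (lineIter U k))) ω y₁ y₂) (idxEquiv Λ p) (idxEquiv Λ q))
          (fun X p q => cX (ldist (N := 2) M) ρ (cubeOf M s) touch (fun ω y₁ y₂ => latticeCw M (chartSet Λ) 2
              (reOp Λ (op240
            ((((B1.aSeq a P.L k / (B1RG242Torus.α P a k * (P.L : ℝ) ^ (k * P.d))) : ℝ) : ℂ) •
              deltaLocT (B1RG242Torus.α P a k * (P.L : ℝ) ^ (k * P.d)) P.eps⁻¹ U k (cubeFam hPd (P.L ^ k) c M0 sg W) (lamFam hPd (P.L ^ k) c M0 sg)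
                (cutoff R₁ R₀ (B5Ineq137Torus.T P 0)))
            κ' (lineIter U k))) ω y₁ y₂) X (idxEquiv Λ p) (idxEquiv Λ q)) := by
  obtain ⟨δ₀, c₀, hδ₀, hc₀, H⟩ := hyp56_printNorm_smallPlaquette_torus_cwt d ℓ hd1 hd3 hℓ hodd ha
  refine ⟨δ₀, c₀, hδ₀, hc₀, ?_⟩
  intro P hPd hPL k hk1 hkK hk' hbig U θ hθ0 hθ hτ c M0 hM0 hfit0 hhalf sg W hsg R R₀ R₁ hRm hR₁ hR10 hW hgap Λ hΛ T₁ δ' σ hInt hTree hσ κ' hκ' hE M hM hMR hMθ ρ s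
  obtain ⟨hγ, hc, hA, hU⟩ := H P hPd hPL k hk1 hkK hk' hbig U θ hθ0 hθ hτ c M0 hM0 hfit0 hhalf sg W hsg R R₀ R₁ hRm hR₁ hR10 hW hgap Λ hΛ T₁ δ' σ
    hInt hTree hσ κ' hκ' hE
  exact eq245_realify_inv hγ hc hδ₀ hA hU hM hMR hMθ ρ s

/-- **(2.41) BY THE WALK ROUTE FOR THE PRINT-NORMALIZED `C^{(k)}_Λ(u)`, PRINTED TORUS DATA, `k`-UNIFORM CONSTANTS**: with `θ_W(γ_P, c_P, δ₀, M)
< 1`, `‖C^{(k)}_Λ(u; x₁, x₂)‖ ≤ 2·2^{d′}γ_P^{−1}(1 − θ_W)^{−1}e^{δ₀/4}·e^{−(δ₀/8)|x₁−x₂|_T/M}` — gen 23's `norm_inv_apply_le_walk`.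
[cite: BalabanImbrieJaffe1988, (2.41) p.264] -/
theorem decay241_walk_printNorm_smallPlaquette_torus_cwt (d ℓ : ℕ) (hd1 : 1 ≤ d) (hd3 : d + 1 ≤ 3) (hℓ : 1 ≤ ℓ) (hodd : Odd (ℓ + 1))
    {a : ℝ} (ha : 0 < a) :
    ∃ δ₀ c₀ : ℝ, 0 < δ₀ ∧ 0 < c₀ ∧ ∀ (P : Params) (hPd : P.d = d + 1), P.L = ℓ + 1 →
      ∀ (k : ℕ), 1 ≤ k → k ≤ P.K → k + 1 ≤ P.m + P.K → 2 * (P.L ^ k - 1) + 4 < P.sitesPerDir 0 →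
      ∀ (U : GaugeField P 0 U1) (θ : ℝ), 0 ≤ θ → (∀ (y : Balaban1983to89.Site P 0) (μ ν : Fin P.d), ‖plaqC U y μ ν - 1‖ ≤ θ) →
        (((P.L : ℝ) ^ k) ^ 2 * θ) ^ 2 ≤ 1 / 500 →
      ∀ (c M0 : Fin (d + 1) → ℕ), (∀ i, 1 ≤ M0 i) → (∀ i, c i * P.L ^ k + P.L ^ k * M0 i ≤ P.sitesPerDir 0) →
        (∀ i, 2 * (P.L ^ k * M0 i) ≤ P.sitesPerDir 0) →
      ∀ (sg W : ℕ), 1 ≤ sg → ∀ (R R₀ R₁ : ℝ), 10 * (P.L : ℝ) ^ k < R → 0 ≤ R₁ → R₁ < R₀ →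
        2 * (sg : ℝ) / 3 + R₀ / 2 + R ≤ W → (∀ i, ((P.L ^ k * M0 i : ℕ) : ℝ) + R ≤ P.sitesPerDir 0) →
      ∀ (Λ : Finset (Balaban1983to89.Site P (0 + k))),
        (∀ y₁ ∈ Λ, ∀ μ, (c (Fin.cast hPd μ) : ℝ) * P.L ^ k + (R₀ + R) ≤ (P.L : ℝ) ^ k * (y₁ μ).val ∧
          (P.L : ℝ) ^ k * (y₁ μ).val + P.L ^ k + (R₀ + R) ≤ (c (Fin.cast hPd μ) : ℝ) * P.L ^ k + (P.L : ℝ) ^ k * M0 (Fin.cast hPd μ)) →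
      ∀ (T₁ δ' σ : ℝ),
        (∀ b : PBond P (0 + k), blkIter 1 b.src = blkIter 1 b.tgt → ‖toC (lineIter U k b) - 1‖ ≤ T₁) →
        (∀ y : Balaban1983to89.Site P (0 + k), ‖holCK (lineIter U k) 1 y - 1‖ ≤ δ') →
        2 * (((P.L : ℝ) - 1) * P.L) * P.d * T₁ ^ 2 + 2 * δ' ^ 2 ≤ σ →
      ∀ (κ' : ℝ), 0 ≤ κ' →
        4 / 3 * (P.d : ℝ) ^ 4 * (((P.L : ℝ) ^ k) ^ 2 * θ) ^ 2 +
            B1.aSeq a P.L k ^ 2 * (c₀ * Real.exp (δ₀ / 2) * latticeConst P.d (δ₀ / 2)) *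
              (((⌊(((P.L : ℝ) ^ k) - 1 + R₀) / sg⌋₊ : ℝ) + 3) ^ (d + 1) *
                  Real.exp (-(δ₀ * (((P.L : ℝ) ^ k)⁻¹ * (2 * R)))) +
                Real.exp (-(δ₀ / 2 * (((P.L : ℝ) ^ k)⁻¹ * R₁)))) <
          c240 P (min (a / (9 * (P.d + 1))) (1 / 12)) κ' * (1 - σ) →
      ∀ (M : ℕ), 5 ≤ M → kR P.d 2 (gammaP P a k θ c₀ δ₀ ((⌊(((P.L : ℝ) ^ k) - 1 + R₀) / sg⌋₊ + 3) ^ (d + 1)) R R₁ σ κ') (cP P a k c₀ δ₀ ((⌊(((P.L : ℝ) ^ k) - 1 + R₀) / sg⌋₊ + 3) ^ (d + 1)) κ') δ₀ < M →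
        thetaConst P.d 2 (gammaP P a k θ c₀ δ₀ ((⌊(((P.L : ℝ) ^ k) - 1 + R₀) / sg⌋₊ + 3) ^ (d + 1)) R R₁ σ κ') (cP P a k c₀ δ₀ ((⌊(((P.L : ℝ) ^ k) - 1 + R₀) / sg⌋₊ + 3) ^ (d + 1)) κ') δ₀ < M →
        thetaW P.d 2 (gammaP P a k θ c₀ δ₀ ((⌊(((P.L : ℝ) ^ k) - 1 + R₀) / sg⌋₊ + 3) ^ (d + 1)) R R₁ σ κ') (cP P a k c₀ δ₀ ((⌊(((P.L : ℝ) ^ k) - 1 + R₀) / sg⌋₊ + 3) ^ (d + 1)) κ') δ₀ M < 1 →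
      ∀ (x₁ x₂ : ↥Λ),
        ‖(compress Λ (op240
            ((((B1.aSeq a P.L k / (B1RG242Torus.α P a k * (P.L : ℝ) ^ (k * P.d))) : ℝ) : ℂ) •
              deltaLocT (B1RG242Torus.α P a k * (P.L : ℝ) ^ (k * P.d)) P.eps⁻¹ U k (cubeFam hPd (P.L ^ k) c M0 sg W) (lamFam hPd (P.L ^ k) c M0 sg)
                (cutoff R₁ R₀ (B5Ineq137Torus.T P 0)))
            κ' (lineIter U k)))⁻¹ x₁ x₂‖ ≤
          2 * (2 ^ P.d * (gammaP P a k θ c₀ δ₀ ((⌊(((P.L : ℝ) ^ k) - 1 + R₀) / sg⌋₊ + 3) ^ (d + 1)) R R₁ σ κ')⁻¹ *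
              (1 - thetaW P.d 2 (gammaP P a k θ c₀ δ₀ ((⌊(((P.L : ℝ) ^ k) - 1 + R₀) / sg⌋₊ + 3) ^ (d + 1)) R R₁ σ κ') (cP P a k c₀ δ₀ ((⌊(((P.L : ℝ) ^ k) - 1 + R₀) / sg⌋₊ + 3) ^ (d + 1)) κ') δ₀ M)⁻¹ *
              Real.exp (δ₀ / 4)) *
            Real.exp (-(δ₀ / 8) * (B5Ineq137Torus.T P (0 + k) x₁.1 x₂.1 / M)) := by
  obtain ⟨δ₀, c₀, hδ₀, hc₀, H⟩ := hyp56_printNorm_smallPlaquette_torus_cwt d ℓ hd1 hd3 hℓ hodd ha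
  refine ⟨δ₀, c₀, hδ₀, hc₀, ?_⟩
  intro P hPd hPL k hk1 hkK hk' hbig U θ hθ0 hθ hτ c M0 hM0 hfit0 hhalf sg W hsg R R₀ R₁ hRm hR₁ hR10 hW hgap Λ hΛ T₁ δ' σ hInt hTree hσ κ' hκ' hE M hM hMR hMθ hθW x₁ x₂
  obtain ⟨hγ, hc, hA, hU⟩ := H P hPd hPL k hk1 hkK hk' hbig U θ hθ0 hθ hτ c M0 hM0 hfit0 hhalf sg W hsg R R₀ R₁ hRm hR₁ hR10 hW hgap Λ hΛ T₁ δ' σ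
    hInt hTree hσ κ' hκ' hE
  exact norm_inv_apply_le_walk hγ hc hδ₀ hA hU hM hMR hMθ hθW x₁ x₂

/-- **(2.46) (typed `Ineq246`) FOR THE PRINT-NORMALIZED `C^{(k)}_Λ(u)`, PRINTED TORUS DATA, `k`-UNIFORM CONSTANTS**: `r(e_k)`-cubes of `s ≥ 1`
labels, `ρ = s/4`, `K₀(γ_P, c_P, δ₀, M) ≤ e^{(δ₀/(128·9^{d′}))s}` — gen 23's `ineq246_walk`. [cite: BalabanImbrieJaffe1988, (2.46) p.264] -/
theorem ineq246_printNorm_smallPlaquette_torus_cwt (d ℓ : ℕ) (hd1 : 1 ≤ d) (hd3 : d + 1 ≤ 3) (hℓ : 1 ≤ ℓ) (hodd : Odd (ℓ + 1)) {a : ℝ}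
    (ha : 0 < a) :
    ∃ δ₀ c₀ : ℝ, 0 < δ₀ ∧ 0 < c₀ ∧ ∀ (P : Params) (hPd : P.d = d + 1), P.L = ℓ + 1 →
      ∀ (k : ℕ), 1 ≤ k → k ≤ P.K → k + 1 ≤ P.m + P.K → 2 * (P.L ^ k - 1) + 4 < P.sitesPerDir 0 →
      ∀ (U : GaugeField P 0 U1) (θ : ℝ), 0 ≤ θ → (∀ (y : Balaban1983to89.Site P 0) (μ ν : Fin P.d), ‖plaqC U y μ ν - 1‖ ≤ θ) →
        (((P.L : ℝ) ^ k) ^ 2 * θ) ^ 2 ≤ 1 / 500 →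
      ∀ (c M0 : Fin (d + 1) → ℕ), (∀ i, 1 ≤ M0 i) → (∀ i, c i * P.L ^ k + P.L ^ k * M0 i ≤ P.sitesPerDir 0) →
        (∀ i, 2 * (P.L ^ k * M0 i) ≤ P.sitesPerDir 0) →
      ∀ (sg W : ℕ), 1 ≤ sg → ∀ (R R₀ R₁ : ℝ), 10 * (P.L : ℝ) ^ k < R → 0 ≤ R₁ → R₁ < R₀ →
        2 * (sg : ℝ) / 3 + R₀ / 2 + R ≤ W → (∀ i, ((P.L ^ k * M0 i : ℕ) : ℝ) + R ≤ P.sitesPerDir 0) →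
      ∀ (Λ : Finset (Balaban1983to89.Site P (0 + k))),
        (∀ y₁ ∈ Λ, ∀ μ, (c (Fin.cast hPd μ) : ℝ) * P.L ^ k + (R₀ + R) ≤ (P.L : ℝ) ^ k * (y₁ μ).val ∧
          (P.L : ℝ) ^ k * (y₁ μ).val + P.L ^ k + (R₀ + R) ≤ (c (Fin.cast hPd μ) : ℝ) * P.L ^ k + (P.L : ℝ) ^ k * M0 (Fin.cast hPd μ)) →
      ∀ (T₁ δ' σ : ℝ),
        (∀ b : PBond P (0 + k), blkIter 1 b.src = blkIter 1 b.tgt → ‖toC (lineIter U k b) - 1‖ ≤ T₁) →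
        (∀ y : Balaban1983to89.Site P (0 + k), ‖holCK (lineIter U k) 1 y - 1‖ ≤ δ') →
        2 * (((P.L : ℝ) - 1) * P.L) * P.d * T₁ ^ 2 + 2 * δ' ^ 2 ≤ σ →
      ∀ (κ' : ℝ), 0 ≤ κ' →
        4 / 3 * (P.d : ℝ) ^ 4 * (((P.L : ℝ) ^ k) ^ 2 * θ) ^ 2 +
            B1.aSeq a P.L k ^ 2 * (c₀ * Real.exp (δ₀ / 2) * latticeConst P.d (δ₀ / 2)) *
              (((⌊(((P.L : ℝ) ^ k) - 1 + R₀) / sg⌋₊ : ℝ) + 3) ^ (d + 1) *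
                  Real.exp (-(δ₀ * (((P.L : ℝ) ^ k)⁻¹ * (2 * R)))) +
                Real.exp (-(δ₀ / 2 * (((P.L : ℝ) ^ k)⁻¹ * R₁)))) <
          c240 P (min (a / (9 * (P.d + 1))) (1 / 12)) κ' * (1 - σ) →
      ∀ (M : ℕ), 5 ≤ M → kR P.d 2 (gammaP P a k θ c₀ δ₀ ((⌊(((P.L : ℝ) ^ k) - 1 + R₀) / sg⌋₊ + 3) ^ (d + 1)) R R₁ σ κ') (cP P a k c₀ δ₀ ((⌊(((P.L : ℝ) ^ k) - 1 + R₀) / sg⌋₊ + 3) ^ (d + 1)) κ') δ₀ < M →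
        thetaConst P.d 2 (gammaP P a k θ c₀ δ₀ ((⌊(((P.L : ℝ) ^ k) - 1 + R₀) / sg⌋₊ + 3) ^ (d + 1)) R R₁ σ κ') (cP P a k c₀ δ₀ ((⌊(((P.L : ℝ) ^ k) - 1 + R₀) / sg⌋₊ + 3) ^ (d + 1)) κ') δ₀ < M →
        thetaW P.d 2 (gammaP P a k θ c₀ δ₀ ((⌊(((P.L : ℝ) ^ k) - 1 + R₀) / sg⌋₊ + 3) ^ (d + 1)) R R₁ σ κ') (cP P a k c₀ δ₀ ((⌊(((P.L : ℝ) ^ k) - 1 + R₀) / sg⌋₊ + 3) ^ (d + 1)) κ') δ₀ M < 1 →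
      ∀ (s : ℕ), 0 < s →
        K0 P.d 2 (gammaP P a k θ c₀ δ₀ ((⌊(((P.L : ℝ) ^ k) - 1 + R₀) / sg⌋₊ + 3) ^ (d + 1)) R R₁ σ κ') (cP P a k c₀ δ₀ ((⌊(((P.L : ℝ) ^ k) - 1 + R₀) / sg⌋₊ + 3) ^ (d + 1)) κ') δ₀ M ≤ Real.exp (δ₀ / (128 * 9 ^ P.d) * s) →
        BIJ88Sect2Statements.Ineq246 (fun X : Finset (Cubes M s (chartSet Λ)) => X.card)
          (fun (p : ↥Λ × Fin 2) (X : Finset (Cubes M s (chartSet Λ))) =>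
            memX (fun (x : B4.Idx (chartSet Λ) 2) (l : ↥(B4Sect5CubeBounds.labels M (chartSet Λ))) =>
              B4Sect5CubeBounds.InBox M l.1 (x.1 : Fin P.d → ℤ)) (cubeOf M s) touch (idxEquiv Λ p) X)
          (fun X p q => cX (ldist (N := 2) M) ((s : ℝ) / 4) (cubeOf M s) touch (fun ω y₁ y₂ => latticeCw M (chartSet Λ) 2
              (reOp Λ (op240
            ((((B1.aSeq a P.L k / (B1RG242Torus.α P a k * (P.L : ℝ) ^ (k * P.d))) : ℝ) : ℂ) •
              deltaLocT (B1RG242Torus.α P a k * (P.L : ℝ) ^ (k * P.d)) P.eps⁻¹ U k (cubeFam hPd (P.L ^ k) c M0 sg W) (lamFam hPd (P.L ^ k) c M0 sg)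
                (cutoff R₁ R₀ (B5Ineq137Torus.T P 0)))
            κ' (lineIter U k))) ω y₁ y₂) X (idxEquiv Λ p) (idxEquiv Λ q))
          (δ₀ / (128 * 9 ^ P.d)) s := by
  obtain ⟨δ₀, c₀, hδ₀, hc₀, H⟩ := hyp56_printNorm_smallPlaquette_torus_cwt d ℓ hd1 hd3 hℓ hodd ha
  refine ⟨δ₀, c₀, hδ₀, hc₀, ?_⟩
  intro P hPd hPL k hk1 hkK hk' hbig U θ hθ0 hθ hτ c M0 hM0 hfit0 hhalf sg W hsg R R₀ R₁ hRm hR₁ hR10 hW hgap Λ hΛ T₁ δ' σ hInt hTree hσ κ' hκ' hE M hM hMR hMθ hθW s hs hlarge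
  obtain ⟨hγ, hc, hA, -⟩ := H P hPd hPL k hk1 hkK hk' hbig U θ hθ0 hθ hτ c M0 hM0 hfit0 hhalf sg W hsg R R₀ R₁ hRm hR₁ hR10 hW hgap Λ hΛ T₁ δ' σ
    hInt hTree hσ κ' hκ' hE
  exact ineq246_walk hγ hc hδ₀ hA hM hMR hMθ hθW hs hlarge

/-- **(2.47) (typed `Close`, torus distance) FOR THE PRINT-NORMALIZED `C^{(k)}_Λ(u)`, PRINTED TORUS DATA, `k`-UNIFORM CONSTANTS**:
`Close (|x₁−x₂|_T/M) C_{Λ,loc} (realify C^{(k)}_Λ(u)) (2^{d′}γ_P^{−1}(1−θ_W)^{−1}e^{−(δ₀/16)(ρ−3)}) (δ₀/16)` — gen 23's `close247_walk`, the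
chart distance being the torus distance on `Λ`. [cite: BalabanImbrieJaffe1988, (2.47) p.265] -/
theorem close247_printNorm_smallPlaquette_torus_cwt (d ℓ : ℕ) (hd1 : 1 ≤ d) (hd3 : d + 1 ≤ 3) (hℓ : 1 ≤ ℓ) (hodd : Odd (ℓ + 1)) {a : ℝ}
    (ha : 0 < a) :
    ∃ δ₀ c₀ : ℝ, 0 < δ₀ ∧ 0 < c₀ ∧ ∀ (P : Params) (hPd : P.d = d + 1), P.L = ℓ + 1 →
      ∀ (k : ℕ), 1 ≤ k → k ≤ P.K → k + 1 ≤ P.m + P.K → 2 * (P.L ^ k - 1) + 4 < P.sitesPerDir 0 →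
      ∀ (U : GaugeField P 0 U1) (θ : ℝ), 0 ≤ θ → (∀ (y : Balaban1983to89.Site P 0) (μ ν : Fin P.d), ‖plaqC U y μ ν - 1‖ ≤ θ) →
        (((P.L : ℝ) ^ k) ^ 2 * θ) ^ 2 ≤ 1 / 500 →
      ∀ (c M0 : Fin (d + 1) → ℕ), (∀ i, 1 ≤ M0 i) → (∀ i, c i * P.L ^ k + P.L ^ k * M0 i ≤ P.sitesPerDir 0) →
        (∀ i, 2 * (P.L ^ k * M0 i) ≤ P.sitesPerDir 0) →
      ∀ (sg W : ℕ), 1 ≤ sg → ∀ (R R₀ R₁ : ℝ), 10 * (P.L : ℝ) ^ k < R → 0 ≤ R₁ → R₁ < R₀ →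
        2 * (sg : ℝ) / 3 + R₀ / 2 + R ≤ W → (∀ i, ((P.L ^ k * M0 i : ℕ) : ℝ) + R ≤ P.sitesPerDir 0) →
      ∀ (Λ : Finset (Balaban1983to89.Site P (0 + k))),
        (∀ y₁ ∈ Λ, ∀ μ, (c (Fin.cast hPd μ) : ℝ) * P.L ^ k + (R₀ + R) ≤ (P.L : ℝ) ^ k * (y₁ μ).val ∧
          (P.L : ℝ) ^ k * (y₁ μ).val + P.L ^ k + (R₀ + R) ≤ (c (Fin.cast hPd μ) : ℝ) * P.L ^ k + (P.L : ℝ) ^ k * M0 (Fin.cast hPd μ)) →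
      ∀ (T₁ δ' σ : ℝ),
        (∀ b : PBond P (0 + k), blkIter 1 b.src = blkIter 1 b.tgt → ‖toC (lineIter U k b) - 1‖ ≤ T₁) →
        (∀ y : Balaban1983to89.Site P (0 + k), ‖holCK (lineIter U k) 1 y - 1‖ ≤ δ') →
        2 * (((P.L : ℝ) - 1) * P.L) * P.d * T₁ ^ 2 + 2 * δ' ^ 2 ≤ σ →
      ∀ (κ' : ℝ), 0 ≤ κ' →
        4 / 3 * (P.d : ℝ) ^ 4 * (((P.L : ℝ) ^ k) ^ 2 * θ) ^ 2 +
            B1.aSeq a P.L k ^ 2 * (c₀ * Real.exp (δ₀ / 2) * latticeConst P.d (δ₀ / 2)) *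
              (((⌊(((P.L : ℝ) ^ k) - 1 + R₀) / sg⌋₊ : ℝ) + 3) ^ (d + 1) *
                  Real.exp (-(δ₀ * (((P.L : ℝ) ^ k)⁻¹ * (2 * R)))) +
                Real.exp (-(δ₀ / 2 * (((P.L : ℝ) ^ k)⁻¹ * R₁)))) <
          c240 P (min (a / (9 * (P.d + 1))) (1 / 12)) κ' * (1 - σ) →
      ∀ (M : ℕ), 5 ≤ M → kR P.d 2 (gammaP P a k θ c₀ δ₀ ((⌊(((P.L : ℝ) ^ k) - 1 + R₀) / sg⌋₊ + 3) ^ (d + 1)) R R₁ σ κ') (cP P a k c₀ δ₀ ((⌊(((P.L : ℝ) ^ k) - 1 + R₀) / sg⌋₊ + 3) ^ (d + 1)) κ') δ₀ < M →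
        thetaConst P.d 2 (gammaP P a k θ c₀ δ₀ ((⌊(((P.L : ℝ) ^ k) - 1 + R₀) / sg⌋₊ + 3) ^ (d + 1)) R R₁ σ κ') (cP P a k c₀ δ₀ ((⌊(((P.L : ℝ) ^ k) - 1 + R₀) / sg⌋₊ + 3) ^ (d + 1)) κ') δ₀ < M →
        thetaW P.d 2 (gammaP P a k θ c₀ δ₀ ((⌊(((P.L : ℝ) ^ k) - 1 + R₀) / sg⌋₊ + 3) ^ (d + 1)) R R₁ σ κ') (cP P a k c₀ δ₀ ((⌊(((P.L : ℝ) ^ k) - 1 + R₀) / sg⌋₊ + 3) ^ (d + 1)) κ') δ₀ M < 1 →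
      ∀ (ρ : ℝ),
        BIJ88Sect2Statements.Close (fun p q : ↥Λ × Fin 2 => B5Ineq137Torus.T P (0 + k) p.1.1 q.1.1 / M)
          (fun p q => cLoc (ldist (N := 2) M) ρ (fun ω y₁ y₂ => latticeCw M (chartSet Λ) 2
              (reOp Λ (op240
            ((((B1.aSeq a P.L k / (B1RG242Torus.α P a k * (P.L : ℝ) ^ (k * P.d))) : ℝ) : ℂ) •
              deltaLocT (B1RG242Torus.α P a k * (P.L : ℝ) ^ (k * P.d)) P.eps⁻¹ U k (cubeFam hPd (P.L ^ k) c M0 sg W) (lamFam hPd (P.L ^ k) c M0 sg)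
                (cutoff R₁ R₀ (B5Ineq137Torus.T P 0)))
            κ' (lineIter U k))) ω y₁ y₂) (idxEquiv Λ p) (idxEquiv Λ q))
          (fun p q => realify (compress Λ (op240
            ((((B1.aSeq a P.L k / (B1RG242Torus.α P a k * (P.L : ℝ) ^ (k * P.d))) : ℝ) : ℂ) •
              deltaLocT (B1RG242Torus.α P a k * (P.L : ℝ) ^ (k * P.d)) P.eps⁻¹ U k (cubeFam hPd (P.L ^ k) c M0 sg W) (lamFam hPd (P.L ^ k) c M0 sg)
                (cutoff R₁ R₀ (B5Ineq137Torus.T P 0)))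
            κ' (lineIter U k)))⁻¹ p q)
          (2 ^ P.d * (gammaP P a k θ c₀ δ₀ ((⌊(((P.L : ℝ) ^ k) - 1 + R₀) / sg⌋₊ + 3) ^ (d + 1)) R R₁ σ κ')⁻¹ *
              (1 - thetaW P.d 2 (gammaP P a k θ c₀ δ₀ ((⌊(((P.L : ℝ) ^ k) - 1 + R₀) / sg⌋₊ + 3) ^ (d + 1)) R R₁ σ κ') (cP P a k c₀ δ₀ ((⌊(((P.L : ℝ) ^ k) - 1 + R₀) / sg⌋₊ + 3) ^ (d + 1)) κ') δ₀ M)⁻¹ *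
            Real.exp (-(δ₀ / 16 * (ρ - 3)))) (δ₀ / 16) := by
  obtain ⟨δ₀, c₀, hδ₀, hc₀, H⟩ := hyp56_printNorm_smallPlaquette_torus_cwt d ℓ hd1 hd3 hℓ hodd ha
  refine ⟨δ₀, c₀, hδ₀, hc₀, ?_⟩
  intro P hPd hPL k hk1 hkK hk' hbig U θ hθ0 hθ hτ c M0 hM0 hfit0 hhalf sg W hsg R R₀ R₁ hRm hR₁ hR10 hW hgap Λ hΛ T₁ δ' σ hInt hTree hσ κ' hκ' hE M hM hMR hMθ hθW ρ p q
  obtain ⟨hγ, hc, hA, hU⟩ := H P hPd hPL k hk1 hkK hk' hbig U θ hθ0 hθ hτ c M0 hM0 hfit0 hhalf sg W hsg R R₀ R₁ hRm hR₁ hR10 hW hgap Λ hΛ T₁ δ' σ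
    hInt hTree hσ κ' hκ' hE
  have hk : 0 + k ≤ P.m + P.K := by omega
  have hPk : (0 : ℝ) < (P.L : ℝ) ^ k := pow_pos P.cast_L_pos k
  have hR : 0 ≤ R := le_trans (by positivity) hRm.le
  have h := close247_walk hγ hc hδ₀ hA hU hM hMR hMθ hθW ρ p q
  dsimp only at h ⊢
  rwa [cdist_eq_T_of_two_mul_abs_le (two_mul_abs_sub_le_of_deep hPd hk (by linarith : 0 ≤ R₀ + R) hhalf (hΛ p.1.1 p.1.2)
    (hΛ q.1.1 q.1.2))] at h

end TorusData

end

end Literature.MathematicalPhysics.QuantumFieldTheory.BalabanImbrieJaffe1984to88.BIJ88Eq242HiggsCovariancePrintNorm
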